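import Summits.QuantumFields.YangMills.Theorems.ChatterjeeMassGapTorusAxialBoxBitCompact
import Summits.QuantumFields.YangMills.Theorems.BalabanLadderNTStrongCouplingCubeIntegral
import HarnessLib

/-!
# Crux `NT` (stmt-QuantumFields-19353), strong-coupling rung: the cube coefficient is POSITIVE for every compact gauge
# group — `κ(∂[0,1]³) = φ^{⋆6}(1) = ‖φ^{⋆3}‖²_{L²(G)} > 0`

Helper file of the fleet lead prover of crux `NT` (unit `ym-spine-19353-p1`, g17) for the typed non-Gaussian first rung
`SkewFloor` (all compact simple `G`, all lattice representations; `Cruxes/NT/Lines/strong_coupling_rung.lean`): the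
general-`G` half of card step (3).  ym-idea-8 g5's `…CubeCumulant.thirdCumulant_cube_sub_leading_le` gives the
finite-volume jet `κ₃^{Λ,β}(φ_p,φ_q,φ_s) = κ(∂[0,1]³)·β³ + O_Λ(β⁴)` with `κ(∂[0,1]³) = ∫ ∏_{t∈∂[0,1]³} φ_t dν` for EVERY
compact `G` and continuous unitary `ρ` (`φ_t = Re tr ρ(U_t) − ∫ Re tr ρ`); `…CubeIntegral` evaluates it to `2⁻⁴` for `SU(2)`.
Here, following the S28ᵀ lane's hypothesis-free gluing (`S28BoxConv.integral_merge_kernel₂`: MERGE with a general kernel;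
convolution powers `P k = φ^{⋆(k+1)}`; `S28BoxBitCompact.boxCumulant_pos` for the ten-face box):

* `cube_conv_step0 … cube_conv_step4` — the six faces of `∂[0,1]³` (oriented coherently: `(e₀;1,2)`, `(e₂;0,1)`,
  `(0;0,2)` enter through their inverse holonomies, immaterial for an inversion-invariant `φ`) are glued one at a time to a
  growing disc; each new face meets the disc in a connected arc, so every step is ONE merge plus free cancellations;
* `cube_integral_eq_conv` — `∫ ∏_{f∈∂[0,1]³} φ(U_f) dν = P 5 (1)` (the sixth convolution power of `φ` at the identity);
* `conv_power_five_at_one_pos`, `cube_integral_pos` — `P 5 (1) = ‖P 2‖² > 0` for `φ ≢ 0`;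
* **`cubeCumulant_pos`** — for every continuous `ρ` with `Re tr ρ(h⁻¹) = Re tr ρ(h)` and non-constant `Re tr ρ`:
  `κ(∂[0,1]³)(G, ρ) > 0` in the literal Finset-product form of `thirdCumulant_cube_sub_leading_le`;
  `cubeCumulant_pos_latticeRep` — the same for the summit's data `r : LatticeRep G` over any `G` with two non-commuting
  elements (every compact simple `G`).

HONEST FRAMING: Haar-measure algebra; nothing about `β`, NT or the gap.  References: M. Creutz, *Quarks, Gluons and
Lattices*, Ch. 8; Drouffe–Zuber, Phys. Rep. 102 (1983) §3.
-/

noncomputable section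

open MeasureTheory Filter Topology
open Literature.MathematicalPhysics.QuantumLattice
open Literature.MathematicalPhysics.QuantumFieldTheory (zdHaar haarProbability LatticeRep)
open Summit.QuantumFields.YangMills.Theorems.S28BoxConv

namespace Summit.QuantumFields.YangMills.Cruxes.NT.StrongCouplingRung

variable {G : Type} [Group G] [TopologicalSpace G] [IsTopologicalGroup G]
  [CompactSpace G] [MeasurableSpace G] [BorelSpace G] [SecondCountableTopology G]

/-! ## The five merges -/

/-- MERGE step 0: across the link `(![0,0,0,0], 1)` (disc function `ψ`, glued face `φ`, merged disc the kernel `K`).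
[folklore] -/
theorem cube_conv_step0 {ψ φ K : G → ℝ} (hψ : Continuous ψ) (hφ : Continuous φ)
    (hψc : ∀ s t : G, ψ (s * t) = ψ (t * s)) (hφc : ∀ s t : G, φ (s * t) = φ (t * s))
    (hKc : ∀ s t : G, K (s * t) = K (t * s))
    (hK : ∀ x y : G, ∫ g, φ (x * g⁻¹) * ψ (g * y) ∂haarProbability G = K (x * y)) :
    ∫ U,
      ψ (U (![0,0,0,0], 1) * U (![0,1,0,0], 2) * (U (![0,0,1,0], 1))⁻¹ * (U (![0,0,0,0], 2))⁻¹) *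
      φ (U (![1,0,0,0], 2) * U (![1,0,1,0], 1) * (U (![1,1,0,0], 2))⁻¹ * (U (![1,0,0,0], 1))⁻¹) *
      φ (U (![0,0,0,0], 0) * U (![1,0,0,0], 1) * (U (![0,1,0,0], 0))⁻¹ * (U (![0,0,0,0], 1))⁻¹) *
      φ (U (![0,0,1,0], 1) * U (![0,1,1,0], 0) * (U (![1,0,1,0], 1))⁻¹ * (U (![0,0,1,0], 0))⁻¹) *
      φ (U (![0,0,0,0], 2) * U (![0,0,1,0], 0) * (U (![1,0,0,0], 2))⁻¹ * (U (![0,0,0,0], 0))⁻¹) *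
      φ (U (![0,1,0,0], 0) * U (![1,1,0,0], 2) * (U (![0,1,1,0], 0))⁻¹ * (U (![0,1,0,0], 2))⁻¹) ∂zdHaar 4 G =
    ∫ U,
      K (U (![0,0,0,0], 0) * U (![1,0,0,0], 1) * (U (![0,1,0,0], 0))⁻¹ * U (![0,1,0,0], 2) * (U (![0,0,1,0], 1))⁻¹ * (U (![0,0,0,0], 2))⁻¹) *
      φ (U (![1,0,0,0], 2) * U (![1,0,1,0], 1) * (U (![1,1,0,0], 2))⁻¹ * (U (![1,0,0,0], 1))⁻¹) *
      φ (U (![0,0,1,0], 1) * U (![0,1,1,0], 0) * (U (![1,0,1,0], 1))⁻¹ * (U (![0,0,1,0], 0))⁻¹) *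
      φ (U (![0,0,0,0], 2) * U (![0,0,1,0], 0) * (U (![1,0,0,0], 2))⁻¹ * (U (![0,0,0,0], 0))⁻¹) *
      φ (U (![0,1,0,0], 0) * U (![1,1,0,0], 2) * (U (![0,1,1,0], 0))⁻¹ * (U (![0,1,0,0], 2))⁻¹) ∂zdHaar 4 G := by
  refine integral_merge_kernel₂ (![0,0,0,0], 1) hφ hψ hφc hψc hKc hK
    (X₁ := (fun U => U (![0,0,0,0], 0) * U (![1,0,0,0], 1) * (U (![0,1,0,0], 0))⁻¹))
    (X₂ := (fun _ => 1))
    (W₁ := (fun _ => 1))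
    (W₂ := (fun U => U (![0,1,0,0], 2) * (U (![0,0,1,0], 1))⁻¹ * (U (![0,0,0,0], 2))⁻¹))
    (Y := (fun U => φ (U (![1,0,0,0], 2) * U (![1,0,1,0], 1) * (U (![1,1,0,0], 2))⁻¹ * (U (![1,0,0,0], 1))⁻¹) *
      φ (U (![0,0,1,0], 1) * U (![0,1,1,0], 0) * (U (![1,0,1,0], 1))⁻¹ * (U (![0,0,1,0], 0))⁻¹) *
      φ (U (![0,0,0,0], 2) * U (![0,0,1,0], 0) * (U (![1,0,0,0], 2))⁻¹ * (U (![0,0,0,0], 0))⁻¹) *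
      φ (U (![0,1,0,0], 0) * U (![1,1,0,0], 2) * (U (![0,1,1,0], 0))⁻¹ * (U (![0,1,0,0], 2))⁻¹)))
    (by fun_prop) (by fun_prop) (by fun_prop) (by fun_prop)
    (fun U g => by simp (disch := decide) only [Function.update_of_ne])
    (fun _ _ => rfl)
    (fun _ _ => rfl)
    (fun U g => by simp (disch := decide) only [Function.update_of_ne])
    (by fun_prop) (fun U g => by simp (disch := decide) only [Function.update_of_ne])
    (fun _ => ?_) fun _ => ?_
  · simp only [one_mul, mul_one, mul_assoc]; ring
  · simp only [mul_one, mul_assoc]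
    try ring

/-- MERGE step 1: across the link `(![0,1,0,0], 0)` (disc function `ψ`, glued face `φ`, merged disc the kernel `K`).
[folklore] -/
theorem cube_conv_step1 {ψ φ K : G → ℝ} (hψ : Continuous ψ) (hφ : Continuous φ)
    (hψc : ∀ s t : G, ψ (s * t) = ψ (t * s)) (hφc : ∀ s t : G, φ (s * t) = φ (t * s))
    (hKc : ∀ s t : G, K (s * t) = K (t * s))
    (hK : ∀ x y : G, ∫ g, ψ (x * g⁻¹) * φ (g * y) ∂haarProbability G = K (x * y)) :
    ∫ U,
      ψ (U (![0,0,0,0], 0) * U (![1,0,0,0], 1) * (U (![0,1,0,0], 0))⁻¹ * U (![0,1,0,0], 2) * (U (![0,0,1,0], 1))⁻¹ * (U (![0,0,0,0], 2))⁻¹) *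
      φ (U (![1,0,0,0], 2) * U (![1,0,1,0], 1) * (U (![1,1,0,0], 2))⁻¹ * (U (![1,0,0,0], 1))⁻¹) *
      φ (U (![0,0,1,0], 1) * U (![0,1,1,0], 0) * (U (![1,0,1,0], 1))⁻¹ * (U (![0,0,1,0], 0))⁻¹) *
      φ (U (![0,0,0,0], 2) * U (![0,0,1,0], 0) * (U (![1,0,0,0], 2))⁻¹ * (U (![0,0,0,0], 0))⁻¹) *
      φ (U (![0,1,0,0], 0) * U (![1,1,0,0], 2) * (U (![0,1,1,0], 0))⁻¹ * (U (![0,1,0,0], 2))⁻¹) ∂zdHaar 4 G =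
    ∫ U,
      K (U (![0,0,0,0], 0) * U (![1,0,0,0], 1) * U (![1,1,0,0], 2) * (U (![0,1,1,0], 0))⁻¹ * (U (![0,0,1,0], 1))⁻¹ * (U (![0,0,0,0], 2))⁻¹) *
      φ (U (![1,0,0,0], 2) * U (![1,0,1,0], 1) * (U (![1,1,0,0], 2))⁻¹ * (U (![1,0,0,0], 1))⁻¹) *
      φ (U (![0,0,1,0], 1) * U (![0,1,1,0], 0) * (U (![1,0,1,0], 1))⁻¹ * (U (![0,0,1,0], 0))⁻¹) *
      φ (U (![0,0,0,0], 2) * U (![0,0,1,0], 0) * (U (![1,0,0,0], 2))⁻¹ * (U (![0,0,0,0], 0))⁻¹) ∂zdHaar 4 G := by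
  refine integral_merge_kernel₂ (![0,1,0,0], 0) hψ hφ hψc hφc hKc hK
    (X₁ := (fun U => U (![0,0,0,0], 0) * U (![1,0,0,0], 1)))
    (X₂ := (fun U => U (![0,1,0,0], 2) * (U (![0,0,1,0], 1))⁻¹ * (U (![0,0,0,0], 2))⁻¹))
    (W₁ := (fun _ => 1))
    (W₂ := (fun U => U (![1,1,0,0], 2) * (U (![0,1,1,0], 0))⁻¹ * (U (![0,1,0,0], 2))⁻¹))
    (Y := (fun U => φ (U (![1,0,0,0], 2) * U (![1,0,1,0], 1) * (U (![1,1,0,0], 2))⁻¹ * (U (![1,0,0,0], 1))⁻¹) *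
      φ (U (![0,0,1,0], 1) * U (![0,1,1,0], 0) * (U (![1,0,1,0], 1))⁻¹ * (U (![0,0,1,0], 0))⁻¹) *
      φ (U (![0,0,0,0], 2) * U (![0,0,1,0], 0) * (U (![1,0,0,0], 2))⁻¹ * (U (![0,0,0,0], 0))⁻¹)))
    (by fun_prop) (by fun_prop) (by fun_prop) (by fun_prop)
    (fun U g => by simp (disch := decide) only [Function.update_of_ne])
    (fun U g => by simp (disch := decide) only [Function.update_of_ne])
    (fun _ _ => rfl)
    (fun U g => by simp (disch := decide) only [Function.update_of_ne])
    (by fun_prop) (fun U g => by simp (disch := decide) only [Function.update_of_ne])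
    (fun _ => ?_) fun _ => ?_
  · simp only [one_mul, mul_assoc]; ring
  · simp only [mul_one, mul_assoc, inv_mul_cancel_left]
    try ring

/-- MERGE step 2: across the link `(![0,1,1,0], 0)` (disc function `ψ`, glued face `φ`, merged disc the kernel `K`).
[folklore] -/
theorem cube_conv_step2 {ψ φ K : G → ℝ} (hψ : Continuous ψ) (hφ : Continuous φ)
    (hψc : ∀ s t : G, ψ (s * t) = ψ (t * s)) (hφc : ∀ s t : G, φ (s * t) = φ (t * s))
    (hKc : ∀ s t : G, K (s * t) = K (t * s))
    (hK : ∀ x y : G, ∫ g, ψ (x * g⁻¹) * φ (g * y) ∂haarProbability G = K (x * y)) :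
    ∫ U,
      ψ (U (![0,0,0,0], 0) * U (![1,0,0,0], 1) * U (![1,1,0,0], 2) * (U (![0,1,1,0], 0))⁻¹ * (U (![0,0,1,0], 1))⁻¹ * (U (![0,0,0,0], 2))⁻¹) *
      φ (U (![1,0,0,0], 2) * U (![1,0,1,0], 1) * (U (![1,1,0,0], 2))⁻¹ * (U (![1,0,0,0], 1))⁻¹) *
      φ (U (![0,0,1,0], 1) * U (![0,1,1,0], 0) * (U (![1,0,1,0], 1))⁻¹ * (U (![0,0,1,0], 0))⁻¹) *
      φ (U (![0,0,0,0], 2) * U (![0,0,1,0], 0) * (U (![1,0,0,0], 2))⁻¹ * (U (![0,0,0,0], 0))⁻¹) ∂zdHaar 4 G =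
    ∫ U,
      K (U (![0,0,0,0], 0) * U (![1,0,0,0], 1) * U (![1,1,0,0], 2) * (U (![1,0,1,0], 1))⁻¹ * (U (![0,0,1,0], 0))⁻¹ * (U (![0,0,0,0], 2))⁻¹) *
      φ (U (![1,0,0,0], 2) * U (![1,0,1,0], 1) * (U (![1,1,0,0], 2))⁻¹ * (U (![1,0,0,0], 1))⁻¹) *
      φ (U (![0,0,0,0], 2) * U (![0,0,1,0], 0) * (U (![1,0,0,0], 2))⁻¹ * (U (![0,0,0,0], 0))⁻¹) ∂zdHaar 4 G := by
  refine integral_merge_kernel₂ (![0,1,1,0], 0) hψ hφ hψc hφc hKc hK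
    (X₁ := (fun U => U (![0,0,0,0], 0) * U (![1,0,0,0], 1) * U (![1,1,0,0], 2)))
    (X₂ := (fun U => (U (![0,0,1,0], 1))⁻¹ * (U (![0,0,0,0], 2))⁻¹))
    (W₁ := (fun U => U (![0,0,1,0], 1)))
    (W₂ := (fun U => (U (![1,0,1,0], 1))⁻¹ * (U (![0,0,1,0], 0))⁻¹))
    (Y := (fun U => φ (U (![1,0,0,0], 2) * U (![1,0,1,0], 1) * (U (![1,1,0,0], 2))⁻¹ * (U (![1,0,0,0], 1))⁻¹) *
      φ (U (![0,0,0,0], 2) * U (![0,0,1,0], 0) * (U (![1,0,0,0], 2))⁻¹ * (U (![0,0,0,0], 0))⁻¹)))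
    (by fun_prop) (by fun_prop) (by fun_prop) (by fun_prop)
    (fun U g => by simp (disch := decide) only [Function.update_of_ne])
    (fun U g => by simp (disch := decide) only [Function.update_of_ne])
    (fun U g => by simp (disch := decide) only [Function.update_of_ne])
    (fun U g => by simp (disch := decide) only [Function.update_of_ne])
    (by fun_prop) (fun U g => by simp (disch := decide) only [Function.update_of_ne])
    (fun _ => ?_) fun _ => ?_
  · simp only [mul_assoc]; ring
  · simp only [mul_assoc, mul_inv_cancel_left]
    try ring

/-- MERGE step 3: across the link `(![0,0,1,0], 0)` (disc function `ψ`, glued face `φ`, merged disc the kernel `K`).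
[folklore] -/
theorem cube_conv_step3 {ψ φ K : G → ℝ} (hψ : Continuous ψ) (hφ : Continuous φ)
    (hψc : ∀ s t : G, ψ (s * t) = ψ (t * s)) (hφc : ∀ s t : G, φ (s * t) = φ (t * s))
    (hKc : ∀ s t : G, K (s * t) = K (t * s))
    (hK : ∀ x y : G, ∫ g, ψ (x * g⁻¹) * φ (g * y) ∂haarProbability G = K (x * y)) :
    ∫ U,
      ψ (U (![0,0,0,0], 0) * U (![1,0,0,0], 1) * U (![1,1,0,0], 2) * (U (![1,0,1,0], 1))⁻¹ * (U (![0,0,1,0], 0))⁻¹ * (U (![0,0,0,0], 2))⁻¹) *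
      φ (U (![1,0,0,0], 2) * U (![1,0,1,0], 1) * (U (![1,1,0,0], 2))⁻¹ * (U (![1,0,0,0], 1))⁻¹) *
      φ (U (![0,0,0,0], 2) * U (![0,0,1,0], 0) * (U (![1,0,0,0], 2))⁻¹ * (U (![0,0,0,0], 0))⁻¹) ∂zdHaar 4 G =
    ∫ U,
      K (U (![0,0,0,0], 0) * U (![1,0,0,0], 1) * U (![1,1,0,0], 2) * (U (![1,0,1,0], 1))⁻¹ * (U (![1,0,0,0], 2))⁻¹ * (U (![0,0,0,0], 0))⁻¹) *
      φ (U (![1,0,0,0], 2) * U (![1,0,1,0], 1) * (U (![1,1,0,0], 2))⁻¹ * (U (![1,0,0,0], 1))⁻¹) ∂zdHaar 4 G := by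
  refine integral_merge_kernel₂ (![0,0,1,0], 0) hψ hφ hψc hφc hKc hK
    (X₁ := (fun U => U (![0,0,0,0], 0) * U (![1,0,0,0], 1) * U (![1,1,0,0], 2) * (U (![1,0,1,0], 1))⁻¹))
    (X₂ := (fun U => (U (![0,0,0,0], 2))⁻¹))
    (W₁ := (fun U => U (![0,0,0,0], 2)))
    (W₂ := (fun U => (U (![1,0,0,0], 2))⁻¹ * (U (![0,0,0,0], 0))⁻¹))
    (Y := (fun U => φ (U (![1,0,0,0], 2) * U (![1,0,1,0], 1) * (U (![1,1,0,0], 2))⁻¹ * (U (![1,0,0,0], 1))⁻¹)))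
    (by fun_prop) (by fun_prop) (by fun_prop) (by fun_prop)
    (fun U g => by simp (disch := decide) only [Function.update_of_ne])
    (fun U g => by simp (disch := decide) only [Function.update_of_ne])
    (fun U g => by simp (disch := decide) only [Function.update_of_ne])
    (fun U g => by simp (disch := decide) only [Function.update_of_ne])
    (by fun_prop) (fun U g => by simp (disch := decide) only [Function.update_of_ne])
    (fun _ => ?_) fun _ => ?_
  · simp only [mul_assoc]; ring
  · simp only [mul_one, mul_assoc, mul_inv_cancel]
    try ring

/-- MERGE step 4: across the link `(![1,0,0,0], 1)` (disc function `ψ`, glued face `φ`, merged disc the kernel `K`).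
[folklore] -/
theorem cube_conv_step4 {ψ φ K : G → ℝ} (hψ : Continuous ψ) (hφ : Continuous φ)
    (hψc : ∀ s t : G, ψ (s * t) = ψ (t * s)) (hφc : ∀ s t : G, φ (s * t) = φ (t * s))
    (hKc : ∀ s t : G, K (s * t) = K (t * s))
    (hK : ∀ x y : G, ∫ g, φ (x * g⁻¹) * ψ (g * y) ∂haarProbability G = K (x * y)) :
    ∫ U,
      ψ (U (![0,0,0,0], 0) * U (![1,0,0,0], 1) * U (![1,1,0,0], 2) * (U (![1,0,1,0], 1))⁻¹ * (U (![1,0,0,0], 2))⁻¹ * (U (![0,0,0,0], 0))⁻¹) *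
      φ (U (![1,0,0,0], 2) * U (![1,0,1,0], 1) * (U (![1,1,0,0], 2))⁻¹ * (U (![1,0,0,0], 1))⁻¹) ∂zdHaar 4 G =
    ∫ _U,
      K 1 ∂zdHaar 4 G := by
  refine integral_merge_kernel₂ (![1,0,0,0], 1) hφ hψ hφc hψc hKc hK
    (X₁ := (fun U => U (![1,0,0,0], 2) * U (![1,0,1,0], 1) * (U (![1,1,0,0], 2))⁻¹))
    (X₂ := (fun _ => 1))
    (W₁ := (fun U => U (![0,0,0,0], 0)))
    (W₂ := (fun U => U (![1,1,0,0], 2) * (U (![1,0,1,0], 1))⁻¹ * (U (![1,0,0,0], 2))⁻¹ * (U (![0,0,0,0], 0))⁻¹))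
    (Y := (fun _ => (1 : ℝ)))
    (by fun_prop) (by fun_prop) (by fun_prop) (by fun_prop)
    (fun U g => by simp (disch := decide) only [Function.update_of_ne])
    (fun _ _ => rfl)
    (fun U g => by simp (disch := decide) only [Function.update_of_ne])
    (fun U g => by simp (disch := decide) only [Function.update_of_ne])
    (by fun_prop) (fun _ _ => rfl)
    (fun _ => ?_) fun _ => ?_
  · simp only [mul_one, mul_assoc]; ring
  · simp only [mul_one, mul_assoc, inv_mul_cancel_left, mul_inv_cancel_left, inv_mul_cancel]
    try ring

/-! ## Orientation, the assembled identity, positivity -/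

omit [MeasurableSpace G] [BorelSpace G] [SecondCountableTopology G] [TopologicalSpace G]
  [IsTopologicalGroup G] [CompactSpace G] in
/-- Coherent orientation of the six faces: for an inversion-invariant `φ` the holonomies of `(e₀;1,2)`, `(e₂;0,1)`, `(0;0,2)`
may be replaced by their inverses. [folklore] -/
theorem cube_orient {φ : G → ℝ} (hinv : ∀ h : G, φ h⁻¹ = φ h) (U : LGConfig 4 G) :
    φ (U (![0,0,0,0], 1) * U (![0,1,0,0], 2) * (U (![0,0,1,0], 1))⁻¹ * (U (![0,0,0,0], 2))⁻¹) *
      φ (U (![1,0,0,0], 1) * U (![1,1,0,0], 2) * (U (![1,0,1,0], 1))⁻¹ * (U (![1,0,0,0], 2))⁻¹) *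
      φ (U (![0,0,0,0], 0) * U (![1,0,0,0], 1) * (U (![0,1,0,0], 0))⁻¹ * (U (![0,0,0,0], 1))⁻¹) *
      φ (U (![0,0,1,0], 0) * U (![1,0,1,0], 1) * (U (![0,1,1,0], 0))⁻¹ * (U (![0,0,1,0], 1))⁻¹) *
      φ (U (![0,0,0,0], 0) * U (![1,0,0,0], 2) * (U (![0,0,1,0], 0))⁻¹ * (U (![0,0,0,0], 2))⁻¹) *
      φ (U (![0,1,0,0], 0) * U (![1,1,0,0], 2) * (U (![0,1,1,0], 0))⁻¹ * (U (![0,1,0,0], 2))⁻¹) =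
    φ (U (![0,0,0,0], 1) * U (![0,1,0,0], 2) * (U (![0,0,1,0], 1))⁻¹ * (U (![0,0,0,0], 2))⁻¹) *
      φ (U (![1,0,0,0], 2) * U (![1,0,1,0], 1) * (U (![1,1,0,0], 2))⁻¹ * (U (![1,0,0,0], 1))⁻¹) *
      φ (U (![0,0,0,0], 0) * U (![1,0,0,0], 1) * (U (![0,1,0,0], 0))⁻¹ * (U (![0,0,0,0], 1))⁻¹) *
      φ (U (![0,0,1,0], 1) * U (![0,1,1,0], 0) * (U (![1,0,1,0], 1))⁻¹ * (U (![0,0,1,0], 0))⁻¹) *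
      φ (U (![0,0,0,0], 2) * U (![0,0,1,0], 0) * (U (![1,0,0,0], 2))⁻¹ * (U (![0,0,0,0], 0))⁻¹) *
      φ (U (![0,1,0,0], 0) * U (![1,1,0,0], 2) * (U (![0,1,1,0], 0))⁻¹ * (U (![0,1,0,0], 2))⁻¹) := by
  have e1 : φ (U (![1,0,0,0], 1) * U (![1,1,0,0], 2) * (U (![1,0,1,0], 1))⁻¹ * (U (![1,0,0,0], 2))⁻¹) = φ (U (![1,0,0,0], 2) * U (![1,0,1,0], 1) * (U (![1,1,0,0], 2))⁻¹ * (U (![1,0,0,0], 1))⁻¹) := by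
    rw [← hinv (U (![1,0,0,0], 1) * U (![1,1,0,0], 2) * (U (![1,0,1,0], 1))⁻¹ * (U (![1,0,0,0], 2))⁻¹)]; simp only [mul_inv_rev, inv_inv, mul_assoc]
  have e2 : φ (U (![0,0,1,0], 0) * U (![1,0,1,0], 1) * (U (![0,1,1,0], 0))⁻¹ * (U (![0,0,1,0], 1))⁻¹) = φ (U (![0,0,1,0], 1) * U (![0,1,1,0], 0) * (U (![1,0,1,0], 1))⁻¹ * (U (![0,0,1,0], 0))⁻¹) := by
    rw [← hinv (U (![0,0,1,0], 0) * U (![1,0,1,0], 1) * (U (![0,1,1,0], 0))⁻¹ * (U (![0,0,1,0], 1))⁻¹)]; simp only [mul_inv_rev, inv_inv, mul_assoc]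
  have e3 : φ (U (![0,0,0,0], 0) * U (![1,0,0,0], 2) * (U (![0,0,1,0], 0))⁻¹ * (U (![0,0,0,0], 2))⁻¹) = φ (U (![0,0,0,0], 2) * U (![0,0,1,0], 0) * (U (![1,0,0,0], 2))⁻¹ * (U (![0,0,0,0], 0))⁻¹) := by
    rw [← hinv (U (![0,0,0,0], 0) * U (![1,0,0,0], 2) * (U (![0,0,1,0], 0))⁻¹ * (U (![0,0,0,0], 2))⁻¹)]; simp only [mul_inv_rev, inv_inv, mul_assoc]
  rw [e1, e2, e3]

/-- **The cube integral is the sixth convolution power at the identity.**  For an inversion-invariant continuous class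
function `φ = P 0` with convolution powers `P (k+1) = P k ⋆ φ` (kernel identities in both orientations):
`∫ ∏_{f∈∂[0,1]³} φ(U_f) dν = P 5 (1)`. [folklore] -/
theorem cube_integral_eq_conv {φ : G → ℝ} {P : ℕ → G → ℝ} (hP0 : P 0 = φ)
    (hPc : ∀ k, Continuous (P k)) (hcl : ∀ (k : ℕ) (s t : G), P k (s * t) = P k (t * s))
    (hinv : ∀ h : G, φ h⁻¹ = φ h)
    (hkerX : ∀ (k : ℕ) (x y : G),
      ∫ g, P k (x * g⁻¹) * φ (g * y) ∂haarProbability G = P (k + 1) (x * y))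
    (hkerW : ∀ (k : ℕ) (x y : G),
      ∫ g, φ (x * g⁻¹) * P k (g * y) ∂haarProbability G = P (k + 1) (x * y)) :
    ∫ U,
      φ (U (![0,0,0,0], 1) * U (![0,1,0,0], 2) * (U (![0,0,1,0], 1))⁻¹ * (U (![0,0,0,0], 2))⁻¹) *
      φ (U (![1,0,0,0], 1) * U (![1,1,0,0], 2) * (U (![1,0,1,0], 1))⁻¹ * (U (![1,0,0,0], 2))⁻¹) *
      φ (U (![0,0,0,0], 0) * U (![1,0,0,0], 1) * (U (![0,1,0,0], 0))⁻¹ * (U (![0,0,0,0], 1))⁻¹) *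
      φ (U (![0,0,1,0], 0) * U (![1,0,1,0], 1) * (U (![0,1,1,0], 0))⁻¹ * (U (![0,0,1,0], 1))⁻¹) *
      φ (U (![0,0,0,0], 0) * U (![1,0,0,0], 2) * (U (![0,0,1,0], 0))⁻¹ * (U (![0,0,0,0], 2))⁻¹) *
      φ (U (![0,1,0,0], 0) * U (![1,1,0,0], 2) * (U (![0,1,1,0], 0))⁻¹ * (U (![0,1,0,0], 2))⁻¹) ∂zdHaar 4 G = P 5 1 := by
  have hφ : Continuous φ := by rw [← hP0]; exact hPc 0
  have hφc : ∀ s t : G, φ (s * t) = φ (t * s) := by rw [← hP0]; exact hcl 0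
  have k0W : ∀ x y : G, ∫ g, φ (x * g⁻¹) * φ (g * y) ∂haarProbability G = P 1 (x * y) :=
    fun x y => by have h := hkerW 0 x y; rw [hP0] at h; exact h
  simp_rw [cube_orient hinv]
  have h0 := cube_conv_step0 (G := G) (ψ := φ) (K := P 1) hφ hφ hφc hφc (hcl 1) k0W
  rw [h0]
  rw [cube_conv_step1 (K := P 2) (hPc 1) hφ (hcl 1) hφc (hcl 2) (hkerX 1)]
  rw [cube_conv_step2 (K := P 3) (hPc 2) hφ (hcl 2) hφc (hcl 3) (hkerX 2)]
  rw [cube_conv_step3 (K := P 4) (hPc 3) hφ (hcl 3) hφc (hcl 4) (hkerX 3)]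
  rw [cube_conv_step4 (K := P 5) (hPc 4) hφ (hcl 4) hφc (hcl 5) (hkerW 4)]
  simp only [integral_const, probReal_univ, one_smul]

omit [SecondCountableTopology G] in
/-- `P 5 (1) = ‖P 2‖² > 0` for a non-zero inversion-invariant continuous class function (chain `P 0 ≢ 0 ⇒ P 1 (1) > 0 ⇒
P 3 (1) > 0 ⇒ P 3, P 2 ≢ 0 ⇒ P 5 (1) > 0`). [folklore] -/
theorem conv_power_five_at_one_pos [T2Space G] {φ : G → ℝ} {P : ℕ → G → ℝ} (hφ : Continuous φ)
    (hcl : ∀ s t : G, φ (s * t) = φ (t * s)) (hinv : ∀ h : G, φ h⁻¹ = φ h) (hP0 : P 0 = φ)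
    (hstep : ∀ k : ℕ, P (k + 1) = haarConv (P k) φ) (h0 : ∃ g, φ g ≠ 0) : 0 < P 5 1 := by
  have ne_of_pos : ∀ {k : ℕ}, 0 < P k 1 → ∃ g, P k g ≠ 0 := fun h => ⟨1, h.ne'⟩
  have h0' : ∃ g, P 0 g ≠ 0 := by rw [hP0]; exact h0
  have h1 : 0 < P 1 1 := conv_power_double_pos hφ hcl hinv hP0 hstep (a := 0) h0'
  have h3 : 0 < P 3 1 := conv_power_double_pos hφ hcl hinv hP0 hstep (a := 1) (ne_of_pos h1)
  have h2 := conv_power_ne_of_succ hstep (k := 2) (ne_of_pos h3)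
  exact conv_power_double_pos hφ hcl hinv hP0 hstep (a := 2) h2

/-- **The cube integral of a non-zero inversion-invariant continuous class function is positive**:
`∫ ∏_{f∈∂[0,1]³} φ(U_f) dν = φ^{⋆6}(1) = ‖φ^{⋆3}‖² > 0`. [folklore] -/
theorem cube_integral_pos [T2Space G] {φ : G → ℝ} (hφ : Continuous φ) (hcl : ∀ s t : G, φ (s * t) = φ (t * s))
    (hinv : ∀ h : G, φ h⁻¹ = φ h) (h0 : ∃ g, φ g ≠ 0) :
    0 < ∫ U,
      φ (U (![0,0,0,0], 1) * U (![0,1,0,0], 2) * (U (![0,0,1,0], 1))⁻¹ * (U (![0,0,0,0], 2))⁻¹) *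
      φ (U (![1,0,0,0], 1) * U (![1,1,0,0], 2) * (U (![1,0,1,0], 1))⁻¹ * (U (![1,0,0,0], 2))⁻¹) *
      φ (U (![0,0,0,0], 0) * U (![1,0,0,0], 1) * (U (![0,1,0,0], 0))⁻¹ * (U (![0,0,0,0], 1))⁻¹) *
      φ (U (![0,0,1,0], 0) * U (![1,0,1,0], 1) * (U (![0,1,1,0], 0))⁻¹ * (U (![0,0,1,0], 1))⁻¹) *
      φ (U (![0,0,0,0], 0) * U (![1,0,0,0], 2) * (U (![0,0,1,0], 0))⁻¹ * (U (![0,0,0,0], 2))⁻¹) *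
      φ (U (![0,1,0,0], 0) * U (![1,1,0,0], 2) * (U (![0,1,1,0], 0))⁻¹ * (U (![0,1,0,0], 2))⁻¹) ∂zdHaar 4 G := by
  obtain ⟨P, hP0, hstep⟩ :
      ∃ P : ℕ → G → ℝ, P 0 = φ ∧ ∀ k : ℕ, P (k + 1) = haarConv (P k) φ :=
    ⟨fun k => Nat.rec φ (fun _ ψ => haarConv ψ φ) k, rfl, fun _ => rfl⟩
  have hPc := conv_power_continuous hφ hP0 hstep
  have hPcl := conv_power_class hcl hP0 hstep
  have hkerX : ∀ (k : ℕ) (x y : G),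
      ∫ g, P k (x * g⁻¹) * φ (g * y) ∂haarProbability G = P (k + 1) (x * y) :=
    fun k x y => by rw [kernel_right, hstep k]
  have hkerW : ∀ (k : ℕ) (x y : G),
      ∫ g, φ (x * g⁻¹) * P k (g * y) ∂haarProbability G = P (k + 1) (x * y) :=
    fun k x y => by rw [kernel_left _ _ (hPcl k), hstep k]
  rw [cube_integral_eq_conv hP0 hPc hPcl hinv hkerX hkerW]
  exact conv_power_five_at_one_pos hφ hcl hinv hP0 hstep h0

/-! ## The cube cumulant of a representation -/

section Rep

open Summit.QuantumFields.YangMills.Theorems.S28OneBitBox (lt01 lt02 lt12)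

variable [T2Space G] {N : ℕ} (ρ : G →* Matrix (Fin N) (Fin N) ℂ)

/-- **The cube coefficient is positive for every compact gauge group.**  For every continuous `ρ` with
`Re tr ρ(h⁻¹) = Re tr ρ(h)` (e.g. unitary) and non-constant `Re tr ρ`: with `φ_t = Re tr ρ(U_t) − ∫ Re tr ρ`,
`κ(∂[0,1]³) = ∫ ∏_{t ∈ ∂[0,1]³} φ_t dν > 0` — in the literal Finset-product form of
`CubeIncidence.thirdCumulant_cube_sub_leading_le`. [folklore] -/
theorem cubeCumulant_pos (hρc : Continuous ρ)
    (hinv : ∀ h : G, ((ρ h⁻¹).trace).re = ((ρ h).trace).re)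
    (hnc : ∃ g : G, ((ρ g).trace).re ≠ ((ρ 1).trace).re) :
    0 < ∫ U, ∏ p ∈ ({(![0,0,0,0], ⟨(1, 2), lt12⟩), (![1,0,0,0], ⟨(1, 2), lt12⟩), (![0,0,0,0], ⟨(0, 1), lt01⟩),
        (![0,0,1,0], ⟨(0, 1), lt01⟩), (![0,0,0,0], ⟨(0, 2), lt02⟩), (![0,1,0,0], ⟨(0, 2), lt02⟩)} :
        Finset (ZdPlaquette 4)),
        ((ρ (U.plaquette p.1 p.2.1.1 p.2.1.2)).trace.re - ∫ g, (ρ g).trace.re ∂haarProbability G) ∂zdHaar 4 G := by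
  classical
  set m := ∫ g, (ρ g).trace.re ∂haarProbability G with hm
  have key := cube_integral_pos (G := G) (φ := fun h => ((ρ h).trace).re - m)
    ((Complex.continuous_re.comp hρc.matrix_trace).sub continuous_const)
    (fun s t => by rw [Summit.QuantumFields.YangMills.Theorems.S28BoxBitSUN.re_trace_map_mul_comm ρ s t])
    (fun h => by rw [hinv h])
    (by
      obtain ⟨g, hg⟩ := hnc
      by_contra h
      simp only [not_exists, not_not, sub_eq_zero] at h
      exact hg ((h g).trans (h 1).symm))
  refine lt_of_lt_of_eq key (integral_congr_ae (Eventually.of_forall fun U => ?_))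
  beta_reduce
  rw [Finset.prod_insert (by decide +kernel), Finset.prod_insert (by decide +kernel),
    Finset.prod_insert (by decide +kernel), Finset.prod_insert (by decide +kernel),
    Finset.prod_insert (by decide +kernel), Finset.prod_singleton]
  simp only [Literature.MathematicalPhysics.QuantumFieldTheory.ZdGaugeConfig.plaquette]
  simp only [(show (![0,0,0,0] : Fin 4 → ℤ) + Pi.single 1 1 = ![0,1,0,0] from by decide +kernel),
    (show (![0,0,0,0] : Fin 4 → ℤ) + Pi.single 2 1 = ![0,0,1,0] from by decide +kernel),
    (show (![1,0,0,0] : Fin 4 → ℤ) + Pi.single 1 1 = ![1,1,0,0] from by decide +kernel),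
    (show (![0,0,0,0] : Fin 4 → ℤ) + Pi.single 0 1 = ![1,0,0,0] from by decide +kernel),
    (show (![0,0,1,0] : Fin 4 → ℤ) + Pi.single 0 1 = ![1,0,1,0] from by decide +kernel),
    (show (![0,0,1,0] : Fin 4 → ℤ) + Pi.single 1 1 = ![0,1,1,0] from by decide +kernel),
    (show (![0,1,0,0] : Fin 4 → ℤ) + Pi.single 0 1 = ![1,1,0,0] from by decide +kernel),
    (show (![0,1,0,0] : Fin 4 → ℤ) + Pi.single 2 1 = ![0,1,1,0] from by decide +kernel),
    (show (![1,0,0,0] : Fin 4 → ℤ) + Pi.single 2 1 = ![1,0,1,0] from by decide +kernel)]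
  ring

/-- **The cube coefficient is positive for the data of the summit statement**: for `r : LatticeRep G` (continuous, faithful,
unitary) over a compact group with an element `≠ 1` (every compact simple `G`), `κ(∂[0,1]³)(G, r.ρ) > 0` — the constant of the
rung `SkewFloor` for `(G, r)` (S28ᵀ tools `re_trace_map_inv_of_mem_unitaryGroup`, `exists_re_trace_ne`). [folklore] -/
theorem cubeCumulant_pos_latticeRep (r : LatticeRep G) (hG : ∃ g : G, g ≠ 1) :
    0 < ∫ U, ∏ p ∈ ({(![0,0,0,0], ⟨(1, 2), lt12⟩), (![1,0,0,0], ⟨(1, 2), lt12⟩), (![0,0,0,0], ⟨(0, 1), lt01⟩),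
        (![0,0,1,0], ⟨(0, 1), lt01⟩), (![0,0,0,0], ⟨(0, 2), lt02⟩), (![0,1,0,0], ⟨(0, 2), lt02⟩)} :
        Finset (ZdPlaquette 4)),
        ((r.ρ (U.plaquette p.1 p.2.1.1 p.2.1.2)).trace.re - ∫ g, (r.ρ g).trace.re ∂haarProbability G) ∂zdHaar 4 G :=
  cubeCumulant_pos r.ρ r.continuous
    (Summit.QuantumFields.YangMills.Theorems.S28BoxBitCompact.re_trace_map_inv_of_mem_unitaryGroup r.ρ r.mem_unitary)
    (Summit.QuantumFields.YangMills.Theorems.S28BoxBitCompact.exists_re_trace_ne r.ρ r.mem_unitary r.injective hG)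

end Rep

end Summit.QuantumFields.YangMills.Cruxes.NT.StrongCouplingRung
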